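import Summits.QuantumFields.YangMills.Theorems.SwapVirialDeficitSectorLaplaceBTubeCapFarFloor
import Summits.QuantumFields.YangMills.Theorems.SwapVirialDeficitBlowUpGnomonicBFibreRescaled
import Summits.QuantumFields.YangMills.Theorems.SwapVirialDeficitSectorLaplaceBulkFibredBox
import HarnessLib

/-!
# THE FAR FLOOR OF THE CAPPED B-TUBE WITH w2's CONSTANT `λ_B` — the `hfar` hypothesis of ✓`bTubeCap_stiff_of_farFloor` DISCHARGED
# (stub `stub_B_stiff` of skeleton ➎ v8 on LEAD sfw-p2 g99's `BTubeCap L τ 1`; free-hands support of ⟨stmt-QuantumFields-24197⟩ `SwapVirialDeficit.SwapGluedStiffness`)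

w2 g59's ✓`bTubeCap_stiff_of_farFloor` (✓`…SectorLaplaceBTubeCapRegion`) proves the (S-B) stiffness on the `(δ, η)`-image `RgCap` of ✓`BTubeCap L τ X₁` modulo ONE
analytic hypothesis, with a HARD-WIRED constant — the B-fibre coercivity `λ_B = τ²/((1+τ²)·12375·L¹⁰)` of ✓`bFibQ_gnoScaleB_ge`:
`hfar : ∀ u, τ² ≤ |u|² → ∀ y : GnoFibreB L, R ≤ ‖y‖ → Ψ′_B(u,y) ∈ RgCap → λ_B·R² ≤ F̂(hubAt (Ψ′_B(u,y)).1 1, ε, (Ψ′_B(u,y)).2)`.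
This file discharges it from the letter floors of ✓`…GnomonicLetterFloors` by a six-way case analysis with the smallness `R ≤ ⅛` (w2's `hsmall` forces `R` far
smaller): if any of `|z|²`, `Σ|η_f|²`, `x₀′²`, `|y|²`, `δ²` is `≥ 1/64` the corresponding single floor already exceeds `λ_B/64 ≥ λ_B R²`; otherwise all five groups are
`< 1/64`, every saturation factor is `≤ 65/64`, and the harmonic combination of the five floors gives `θR² ≤ 4838·L¹⁰·F̂ ≤ 12375·L¹⁰·F̂` (`θ = τ²/(1+τ²) ≤ ⅕`):
* `bfar_cap_scalar_lambdaB` — the pure real-arithmetic heart (inputs: the six floors as real inequalities, `τ² ≤ |u|²`, `δ² ≤ ⅓`, the cap `x₀² ≤ 1 + |u|²`, `|Fol L| ≤ 6L⁴`);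
* `bfar_sum_frac_ge` (`Σ t_f/(1+t_f) ≥ (Σt_f)/(1+Σt_f)`), `card_fol_real_le` (`|Fol L| ≤ 6L⁴`, ✓`card_fol`);
* ★★★ `bTubeCap_far_floor_lambdaB (δ τ R) (hτ : 0 < τ) (hτ2 : τ ≤ ½) (hδ : δ² ≤ ⅓) (hR0 : 0 ≤ R) (hR8 : R ≤ ⅛) (ε) (η) (hu : τ² ≤ |u|²) (hx0 : x₀² ≤ 1 + |u|²)
  (hfar : R² ≤ δ² + x₀²/(1+|u|²) + |y|² + |z|² + Σ|η_f|²) : τ²/((1+τ²)·12375·L¹⁰)·R² ≤ gnoDeficit 0 1 (hubAt δ 1) ε η` — EVERY sign pattern;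
* ★★★ `bTubeCap_hfar (ε) (hτ : 0 < τ) (hτ2 : τ ≤ ½) (hX0 : 0 ≤ X₁) (hX1 : X₁ ≤ 1) (hR0 : 0 ≤ R) (hR8 : R ≤ ⅛)` : LITERALLY the `hfar` of ✓`bTubeCap_stiff_of_farFloor`
  (w2's rescaled letters via ✓`gnoFibreBEquiv_gnoScaleB` ∕ ✓`norm_sq_gnoFibreB_letters`; the seam window `|δ| < τ√(1+δ²)` gives `δ² ≤ ⅓`, the cap gives `x₀² ≤ X₁²(1+|u|²)`).
So `stub_B_stiff` is now closed modulo (i) the `BTubeCap` reading (w2's ⧗`…BTubeCapHubCot`) and (ii) the conversion of w2's two explicit smallness conditions and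
`R ≤ ⅛`, `R ≤ X₁ = 1`, `2R < τ` into g47's polynomial threshold `K·L^k·τ^{-k} ≤ b`.

HONEST LABEL: quaternion∕real bookkeeping on landed inequalities; `stub_B_stiff` NOT yet closed by name (items (i)–(ii) above); stubs core-tip∕core-end∕001-good,
⟨24197⟩ ∕ ⟨24194⟩ and every rung OPEN; own crux ⟨22884⟩ `LargeFieldMassRefinementTail` OPEN (blocked-on ⟨19935⟩); no crux, rung of record or summit is proved;
the Yang–Mills mass gap is NOT proved; no summit is proved by a line.  THEOREMS ONLY (0 `def`, 0 `sorry`), standard axioms.  Width seat ym-line-sfw-p2-w3 g67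
(cell ym-idea-1, free hands), `--supports stmt-QuantumFields-24197`.  References: [cite: Luscher1983, §2]; [cite: tHooft1979]; [folklore].
-/

set_option autoImplicit false

noncomputable section

open MeasureTheory Quaternion
open scoped BigOperators Quaternion
open Literature.MathematicalPhysics.QuantumFieldTheory hiding SU2
open Literature.MathematicalPhysics.QuantumLattice
open Literature.Analysis.Calculus (radialUnit radialUnit_def norm_radialUnit)

namespace Summit.QuantumFields.YangMills.Theorems.SwapVirialDeficit.BlowUpRing

open Summit.QuantumFields.YangMills.Theorems.FemtoTransferGap
open Summit.QuantumFields.YangMills.Theorems.FemtoTransferGap.TT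
open Summit.QuantumFields.YangMills.Theorems.VirialFluxGap.RingDeficit
open Summit.QuantumFields.YangMills.Theorems.SwapVirialDeficit.SwapRing
open Summit.QuantumFields.YangMills.Theorems.SwapTwistDeficit.ToronLog (axisPoint)
open Summit.QuantumFields.YangMills.Theorems.SwapVirialDeficit.Gnomonic (normSq3)

variable {L : ℕ} [NeZero L]

/-! ## §1 The scalar heart, the letter form, the socket -/

omit [NeZero L] in
/-- ★ **THE SCALAR HEART OF THE FAR FLOOR WITH w2's CONSTANT `λ_B = τ²/((1+τ²)·12375·L¹⁰)`**: from the six letter floors at the hub `(δ,1,0,0)` (read as real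
inequalities with `M = L⁶`, `M₄ = L⁴`, `N = |Fol L| ≤ 6M₄`), the tube data `τ² ≤ |u|²`, `0 < τ ≤ ½`, the seam window `δ² ≤ ⅓`, the axial cap `x₀² ≤ 1 + |u|²`
(`X₁ = 1`) and a FAR fibre displacement `R² ≤ δ² + x₀²/(1+|u|²) + |y|² + |z|² + Σ|η_f|²` with `0 ≤ R ≤ ⅛`: `λ_B·R² ≤ F`. [folklore] -/
theorem bfar_cap_scalar_lambdaB {δ τ x₀ x₁ x₂ y₀ y₁ y₂ Sz SF Φ M M₄ N F R : ℝ} (hτ : 0 < τ) (hτ2 : τ ≤ 1 / 2) (hδ : δ ^ 2 ≤ 1 / 3)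
    (hM : 1 ≤ M) (hM₄ : 1 ≤ M₄) (hN6 : N ≤ 6 * M₄) (hF : 0 ≤ F) (hSz : 0 ≤ Sz) (hSF : 0 ≤ SF) (hR0 : 0 ≤ R) (hR8 : R ≤ 1 / 8)
    (hu : τ ^ 2 ≤ x₁ ^ 2 + x₂ ^ 2) (hx0 : x₀ ^ 2 ≤ 1 + (x₁ ^ 2 + x₂ ^ 2))
    (fz : Sz / (1 + Sz) ≤ 1800 * M * F)
    (fy : 4 * 1 ^ 2 * (y₁ ^ 2 + y₂ ^ 2) / ((1 + δ ^ 2) * (1 + (y₀ ^ 2 + y₁ ^ 2 + y₂ ^ 2))) ≤ 1800 * M * F)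
    (fyx : 4 * ((x₂ * y₀ - x₀ * y₂) ^ 2 + (x₀ * y₁ - x₁ * y₀) ^ 2) / ((1 + (x₀ ^ 2 + x₁ ^ 2 + x₂ ^ 2)) * (1 + (y₀ ^ 2 + y₁ ^ 2 + y₂ ^ 2))) ≤
      1800 * M * F)
    (fδ : 16 * δ ^ 2 * 1 ^ 2 * (x₁ ^ 2 + x₂ ^ 2) / ((1 + δ ^ 2) ^ 2 * (1 + (x₀ ^ 2 + x₁ ^ 2 + x₂ ^ 2))) ≤ 7200 * M * F)
    (ft : 16 * 1 ^ 2 * x₀ ^ 2 * (x₁ ^ 2 + x₂ ^ 2) / ((1 + δ ^ 2) * (1 + (x₀ ^ 2 + x₁ ^ 2 + x₂ ^ 2)) ^ 2) ≤ 18000 * M * F)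
    (fF : Φ ≤ 1152 * M * N * F) (hΦ : SF / (1 + SF) ≤ Φ)
    (hfar : R ^ 2 ≤ δ ^ 2 + x₀ ^ 2 / (1 + (x₁ ^ 2 + x₂ ^ 2)) + (y₀ ^ 2 + y₁ ^ 2 + y₂ ^ 2) + Sz + SF) :
    τ ^ 2 / ((1 + τ ^ 2) * (12375 * (M₄ * M))) * R ^ 2 ≤ F := by
  -- the algebraic identity behind the axial `y`-letter
  have hPb : y₀ ^ 2 * (x₁ ^ 2 + x₂ ^ 2) ≤ 2 * ((x₂ * y₀ - x₀ * y₂) ^ 2 + (x₀ * y₁ - x₁ * y₀) ^ 2) + 2 * x₀ ^ 2 * (y₁ ^ 2 + y₂ ^ 2) := by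
    nlinarith only [sq_nonneg (x₂ * y₀ - 2 * x₀ * y₂), sq_nonneg (x₁ * y₀ - 2 * x₀ * y₁)]
  -- opaque abbreviations
  set U : ℝ := x₁ ^ 2 + x₂ ^ 2 with hU
  set Q : ℝ := y₁ ^ 2 + y₂ ^ 2 with hQ
  set Sy : ℝ := y₀ ^ 2 + y₁ ^ 2 + y₂ ^ 2 with hSy
  set P : ℝ := (x₂ * y₀ - x₀ * y₂) ^ 2 + (x₀ * y₁ - x₁ * y₀) ^ 2 with hP
  set θ : ℝ := τ ^ 2 / (1 + τ ^ 2) with hθ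
  have hQ0 : 0 ≤ Q := by rw [hQ]; positivity
  have hSy0 : 0 ≤ Sy := by rw [hSy]; positivity
  have hP0 : 0 ≤ P := by rw [hP]; positivity
  have hθpos : 0 < θ := by rw [hθ]; positivity
  have hθ5 : θ ≤ 1 / 5 := by
    rw [hθ, div_le_div_iff₀ (by positivity) (by norm_num)]; nlinarith only [hτ2, hτ]
  have hθU : θ ≤ U / (1 + U) := by rw [hθ]; exact bfar_frac_mono (by positivity) hu
  have hSyQ : Sy = y₀ ^ 2 + Q := by rw [hSy, hQ]; ring
  have hlam : τ ^ 2 / ((1 + τ ^ 2) * (12375 * (M₄ * M))) = θ / (12375 * (M₄ * M)) := by rw [hθ]; field_simp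
  clear_value U Q Sy P θ
  rw [hlam]
  -- positivity facts
  have hU0 : 0 < U := lt_of_lt_of_le (pow_pos hτ 2) hu
  have hU1 : 0 < 1 + U := by linarith only [hU0]
  have hT : 0 < 1 + (x₀ ^ 2 + U) := by nlinarith only [hU0, sq_nonneg x₀]
  have hY : 0 < 1 + Sy := by linarith only [hSy0]
  have hd2 : 0 < 1 + δ ^ 2 := by positivity
  have hTne : 1 + (x₀ ^ 2 + U) ≠ 0 := hT.ne'
  have hYne : 1 + Sy ≠ 0 := hY.ne'
  have hU1ne : 1 + U ≠ 0 := hU1.ne'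
  have hMM : 1 ≤ M₄ * M := by nlinarith only [hM, hM₄]
  have hMM0 : 0 < M₄ * M := by linarith only [hMM]
  have hMF : 0 ≤ M * F := by positivity
  have hR2 : R ^ 2 ≤ 1 / 64 := by nlinarith only [hR0, hR8]
  -- normal forms of the floors
  have hT' : 1 + (x₀ ^ 2 + x₁ ^ 2 + x₂ ^ 2) = 1 + (x₀ ^ 2 + U) := by rw [hU]; ring
  rw [hT'] at fyx fδ ft
  simp only [one_pow, mul_one] at fy fδ ft
  -- the two ratios `t₀ = U/T`, `r = x₀²/T`
  have ht0pos : 0 < U / (1 + (x₀ ^ 2 + U)) := div_pos hU0 hT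
  have ht0le : U / (1 + (x₀ ^ 2 + U)) ≤ 1 := by rw [div_le_one hT]; nlinarith only [sq_nonneg x₀]
  have hr0 : 0 ≤ x₀ ^ 2 / (1 + (x₀ ^ 2 + U)) := div_nonneg (sq_nonneg _) hT.le
  have hQY0 : 0 ≤ Q / (1 + Sy) := div_nonneg hQ0 hY.le
  -- rewrite the floors through the ratios
  have fδ' : 16 * δ ^ 2 / (1 + δ ^ 2) ^ 2 * (U / (1 + (x₀ ^ 2 + U))) ≤ 7200 * M * F := by
    have e : 16 * δ ^ 2 * U / ((1 + δ ^ 2) ^ 2 * (1 + (x₀ ^ 2 + U))) = 16 * δ ^ 2 / (1 + δ ^ 2) ^ 2 * (U / (1 + (x₀ ^ 2 + U))) := by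
      field_simp
    rw [← e]; exact fδ
  have ft' : 16 / (1 + δ ^ 2) * ((x₀ ^ 2 / (1 + (x₀ ^ 2 + U))) * (U / (1 + (x₀ ^ 2 + U)))) ≤ 18000 * M * F := by
    have e : 16 * x₀ ^ 2 * U / ((1 + δ ^ 2) * (1 + (x₀ ^ 2 + U)) ^ 2) =
        16 / (1 + δ ^ 2) * ((x₀ ^ 2 / (1 + (x₀ ^ 2 + U))) * (U / (1 + (x₀ ^ 2 + U)))) := by
      field_simp
    rw [← e]; exact ft
  have fQ : Q / (1 + Sy) ≤ 450 * (1 + δ ^ 2) * (M * F) := by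
    have e : 4 * Q / ((1 + δ ^ 2) * (1 + Sy)) = (4 / (1 + δ ^ 2)) * (Q / (1 + Sy)) := by field_simp
    rw [e] at fy
    have h2 : 4 / (1 + δ ^ 2) * (Q / (1 + Sy)) * (1 + δ ^ 2) = 4 * (Q / (1 + Sy)) := by field_simp
    have h3 := mul_le_mul_of_nonneg_right fy hd2.le
    rw [h2] at h3
    linarith only [h3]
  have fQ' : Q / (1 + Sy) ≤ 600 * (M * F) := by nlinarith only [fQ, hδ, hMF]
  -- the axial `y`-letter through the ratios: `t₀·y₀²/Y ≤ 900MF + 2·r·(Q/Y)`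
  have fy0 : (U / (1 + (x₀ ^ 2 + U))) * (y₀ ^ 2 / (1 + Sy)) ≤ 900 * (M * F) + 2 * (x₀ ^ 2 / (1 + (x₀ ^ 2 + U))) * (Q / (1 + Sy)) := by
    have h2 : (U / (1 + (x₀ ^ 2 + U))) * (y₀ ^ 2 / (1 + Sy)) = (y₀ ^ 2 * U) / ((1 + (x₀ ^ 2 + U)) * (1 + Sy)) := by field_simp
    have h3 : (y₀ ^ 2 * U) / ((1 + (x₀ ^ 2 + U)) * (1 + Sy)) ≤ (2 * P + 2 * x₀ ^ 2 * Q) / ((1 + (x₀ ^ 2 + U)) * (1 + Sy)) :=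
      div_le_div_of_nonneg_right hPb (mul_pos hT hY).le
    have h4 : (2 * P + 2 * x₀ ^ 2 * Q) / ((1 + (x₀ ^ 2 + U)) * (1 + Sy)) =
        (1 / 2) * (4 * P / ((1 + (x₀ ^ 2 + U)) * (1 + Sy))) + 2 * (x₀ ^ 2 / (1 + (x₀ ^ 2 + U))) * (Q / (1 + Sy)) := by
      field_simp; ring
    rw [h2]; linarith only [h3, h4, fyx]
  -- followers: `Φ ≤ 6912·M·M₄·F`
  have fF' : Φ ≤ 6912 * (M₄ * M) * F := by
    have h1 : 1152 * M * N * F ≤ 1152 * M * (6 * M₄) * F := by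
      have := mul_le_mul_of_nonneg_left hN6 (show 0 ≤ 1152 * M * F by positivity); nlinarith only [this]
    nlinarith only [fF, h1]
  -- the target in the form `θ·R² ≤ 12375·(M₄M)·F`
  rw [div_mul_eq_mul_div, div_le_iff₀ (by positivity)]
  -- CASE 1: `Sz ≥ 1/64`
  rcases le_or_gt (1 / 64 : ℝ) Sz with hz1 | hz1
  · have h1 : (1 / 64 : ℝ) / (1 + 1 / 64) ≤ Sz / (1 + Sz) := bfar_frac_mono (by norm_num) hz1
    have h2 : (1 : ℝ) / 65 ≤ 1800 * M * F := by rw [show (1 : ℝ) / 65 = 1 / 64 / (1 + 1 / 64) by norm_num]; exact h1.trans fz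
    nlinarith only [h2, hθ5, hθpos, hR2, hMM, hM₄, hM, hF, hR0]
  -- CASE 2: `SF ≥ 1/64`
  rcases le_or_gt (1 / 64 : ℝ) SF with hF1 | hF1
  · have h1 : (1 / 64 : ℝ) / (1 + 1 / 64) ≤ SF / (1 + SF) := bfar_frac_mono (by norm_num) hF1
    have h2 : (1 : ℝ) / 65 ≤ 6912 * (M₄ * M) * F := by
      rw [show (1 : ℝ) / 65 = 1 / 64 / (1 + 1 / 64) by norm_num]; exact h1.trans (hΦ.trans fF')
    nlinarith only [h2, hθ5, hθpos, hR2, hMM, hF, hR0]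
  -- the cap: `X2 = x₀²/(1+U) ≤ 1`, and `T = (1+U)(1+X2)`
  have hX2le : x₀ ^ 2 / (1 + U) ≤ 1 := by rw [div_le_one hU1]; exact hx0
  have hX20 : 0 ≤ x₀ ^ 2 / (1 + U) := div_nonneg (sq_nonneg _) hU1.le
  have hTfac : 1 + (x₀ ^ 2 + U) = (1 + U) * (1 + x₀ ^ 2 / (1 + U)) := by field_simp; ring
  have ht0eq : U / (1 + (x₀ ^ 2 + U)) = (U / (1 + U)) / (1 + x₀ ^ 2 / (1 + U)) := by rw [hTfac, div_div]
  have hreq : x₀ ^ 2 / (1 + (x₀ ^ 2 + U)) = (x₀ ^ 2 / (1 + U)) / (1 + x₀ ^ 2 / (1 + U)) := by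
    rw [hTfac]; field_simp
  have hX21 : 0 < 1 + x₀ ^ 2 / (1 + U) := by linarith only [hX20]
  -- CASE 3: `X2 ≥ 1/64`
  rcases le_or_gt (1 / 64 : ℝ) (x₀ ^ 2 / (1 + U)) with hx1 | hx1
  · have hr : (1 : ℝ) / 65 ≤ x₀ ^ 2 / (1 + (x₀ ^ 2 + U)) := by
      rw [hreq, show (1 : ℝ) / 65 = 1 / 64 / (1 + 1 / 64) by norm_num]; exact bfar_frac_mono (by norm_num) hx1
    have ht : θ / 2 ≤ U / (1 + (x₀ ^ 2 + U)) := by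
      rw [ht0eq]
      calc θ / 2 ≤ θ / (1 + x₀ ^ 2 / (1 + U)) := div_le_div_of_nonneg_left hθpos.le hX21 (by linarith only [hX2le])
        _ ≤ (U / (1 + U)) / (1 + x₀ ^ 2 / (1 + U)) := div_le_div_of_nonneg_right hθU hX21.le
    have h16 : (12 : ℝ) ≤ 16 / (1 + δ ^ 2) := by rw [le_div_iff₀ hd2]; nlinarith only [hδ]
    have hprod : (1 / 65) * (θ / 2) ≤ (x₀ ^ 2 / (1 + (x₀ ^ 2 + U))) * (U / (1 + (x₀ ^ 2 + U))) :=
      mul_le_mul hr ht (by positivity) hr0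
    have h3 : 12 * ((1 / 65) * (θ / 2)) ≤ 16 / (1 + δ ^ 2) * ((x₀ ^ 2 / (1 + (x₀ ^ 2 + U))) * (U / (1 + (x₀ ^ 2 + U)))) :=
      mul_le_mul h16 hprod (by positivity) (by positivity)
    nlinarith only [h3, ft', hθpos, hR2, hMM, hF, hR0, hM₄]
  -- now `X2 < 1/64`: the angle ratio is `≥ (64/65)θ`
  have ht064 : 64 / 65 * θ ≤ U / (1 + (x₀ ^ 2 + U)) := by
    rw [ht0eq, show (64 : ℝ) / 65 * θ = θ / (1 + 1 / 64) by ring]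
    calc θ / (1 + 1 / 64) ≤ θ / (1 + x₀ ^ 2 / (1 + U)) := div_le_div_of_nonneg_left hθpos.le hX21 (by linarith only [hx1])
      _ ≤ (U / (1 + U)) / (1 + x₀ ^ 2 / (1 + U)) := div_le_div_of_nonneg_right hθU hX21.le
  have hrle : x₀ ^ 2 / (1 + (x₀ ^ 2 + U)) ≤ x₀ ^ 2 / (1 + U) := div_le_div_of_nonneg_left (sq_nonneg _) hU1 (by nlinarith only [sq_nonneg x₀])
  -- CASE 4: `Sy ≥ 1/64`
  rcases le_or_gt (1 / 64 : ℝ) Sy with hy1 | hy1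
  · have hfr : (1 : ℝ) / 65 ≤ Sy / (1 + Sy) := by
      rw [show (1 : ℝ) / 65 = 1 / 64 / (1 + 1 / 64) by norm_num]; exact bfar_frac_mono (by norm_num) hy1
    -- `t₀·Sy/Y ≤ 1520MF`
    have h1 : 2 * (x₀ ^ 2 / (1 + (x₀ ^ 2 + U))) * (Q / (1 + Sy)) ≤ 2 * (1 / 64) * (600 * (M * F)) :=
      mul_le_mul (by nlinarith only [hrle, hx1, hr0]) fQ' hQY0 (by positivity)
    have h2 : (U / (1 + (x₀ ^ 2 + U))) * (Q / (1 + Sy)) ≤ 1 * (600 * (M * F)) := mul_le_mul ht0le fQ' hQY0 zero_le_one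
    have hsplit : Sy / (1 + Sy) = y₀ ^ 2 / (1 + Sy) + Q / (1 + Sy) := by rw [← add_div, ← hSyQ]
    have h3 : (U / (1 + (x₀ ^ 2 + U))) * (Sy / (1 + Sy)) ≤ 1520 * (M * F) := by rw [hsplit, mul_add]; linarith only [fy0, h1, h2, hMF]
    have h4 : (64 / 65 * θ) * (1 / 65) ≤ (U / (1 + (x₀ ^ 2 + U))) * (Sy / (1 + Sy)) := mul_le_mul ht064 hfr (by norm_num) ht0pos.le
    nlinarith only [h3, h4, hθpos, hR2, hMM, hF, hR0, hM₄]
  -- CASE 5: `δ² ≥ 1/64`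
  rcases le_or_gt (1 / 64 : ℝ) (δ ^ 2) with hd1 | hd1
  · have h1 : (9 : ℝ) / 64 ≤ 16 * δ ^ 2 / (1 + δ ^ 2) ^ 2 := by
      rw [le_div_iff₀ (by positivity)]; nlinarith only [hd1, hδ, sq_nonneg δ]
    have h2 : (9 / 64) * (64 / 65 * θ) ≤ 16 * δ ^ 2 / (1 + δ ^ 2) ^ 2 * (U / (1 + (x₀ ^ 2 + U))) := mul_le_mul h1 ht064 (by positivity) (by positivity)
    nlinarith only [h2, fδ', hθpos, hR2, hMM, hF, hR0, hM₄]
  -- CASE 6: all five groups `< 1/64` — upper bounds for each group, then the sum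
  have bδ : δ ^ 2 * θ ≤ 480 * (M * F) := by
    -- 16δ²t₀/(1+δ²)² ≥ 16δ²(64θ/65)/(65/64)²
    have h1 : 16 * δ ^ 2 / (1 + δ ^ 2) ^ 2 ≥ 16 * δ ^ 2 / ((65 / 64) ^ 2) := by
      apply div_le_div_of_nonneg_left (by positivity) (by positivity); nlinarith only [hd1, sq_nonneg δ]
    have h2 : 16 * δ ^ 2 / ((65 / 64 : ℝ) ^ 2) * (64 / 65 * θ) ≤ 16 * δ ^ 2 / (1 + δ ^ 2) ^ 2 * (U / (1 + (x₀ ^ 2 + U))) :=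
      mul_le_mul h1 ht064 (by positivity) (by positivity)
    have h3 : 16 * δ ^ 2 / ((65 / 64 : ℝ) ^ 2) * (64 / 65 * θ) = (16 * 64 ^ 3 / 65 ^ 3) * (δ ^ 2 * θ) := by ring
    rw [h3] at h2
    linarith only [h2, fδ', hMF]
  have bX : x₀ ^ 2 / (1 + U) * θ ≤ 1200 * (M * F) := by
    have h16 : (16 : ℝ) * (64 / 65) ≤ 16 / (1 + δ ^ 2) := by rw [le_div_iff₀ hd2]; nlinarith only [hd1]
    have hr : x₀ ^ 2 / (1 + U) * (64 / 65) ≤ x₀ ^ 2 / (1 + (x₀ ^ 2 + U)) := by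
      rw [hreq, le_div_iff₀ hX21]; nlinarith only [hx1, hX20]
    have hprod : (x₀ ^ 2 / (1 + U) * (64 / 65)) * (64 / 65 * θ) ≤ (x₀ ^ 2 / (1 + (x₀ ^ 2 + U))) * (U / (1 + (x₀ ^ 2 + U))) :=
      mul_le_mul hr ht064 (by positivity) hr0
    have h3 : (16 * (64 / 65)) * ((x₀ ^ 2 / (1 + U) * (64 / 65)) * (64 / 65 * θ)) ≤
        16 / (1 + δ ^ 2) * ((x₀ ^ 2 / (1 + (x₀ ^ 2 + U))) * (U / (1 + (x₀ ^ 2 + U)))) := mul_le_mul h16 hprod (by positivity) (by positivity)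
    have h4 : (16 * (64 / 65)) * ((x₀ ^ 2 / (1 + U) * (64 / 65)) * (64 / 65 * θ)) = (16 * 64 ^ 3 / 65 ^ 3) * (x₀ ^ 2 / (1 + U) * θ) := by ring
    rw [h4] at h3
    linarith only [h3, ft', hMF]
  have bY : Sy * θ ≤ 1450 * (M * F) := by
    have h1 : 2 * (x₀ ^ 2 / (1 + (x₀ ^ 2 + U))) * (Q / (1 + Sy)) ≤ 2 * (1 / 64) * (Q / (1 + Sy)) :=
      mul_le_mul_of_nonneg_right (by nlinarith only [hrle, hx1, hr0]) hQY0
    have hQ2 : Q / (1 + Sy) ≤ 458 * (M * F) := by nlinarith only [fQ, hd1, hMF]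
    have h2 : (U / (1 + (x₀ ^ 2 + U))) * (Q / (1 + Sy)) ≤ 1 * (458 * (M * F)) := mul_le_mul ht0le hQ2 hQY0 zero_le_one
    have hsplit : Sy / (1 + Sy) = y₀ ^ 2 / (1 + Sy) + Q / (1 + Sy) := by rw [← add_div, ← hSyQ]
    have h3 : (U / (1 + (x₀ ^ 2 + U))) * (Sy / (1 + Sy)) ≤ 1373 * (M * F) := by rw [hsplit, mul_add]; linarith only [fy0, h1, h2, hQ2, hMF]
    have h4 : (64 / 65 * θ) * (Sy / (1 + Sy)) ≤ (U / (1 + (x₀ ^ 2 + U))) * (Sy / (1 + Sy)) :=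
      mul_le_mul_of_nonneg_right ht064 (div_nonneg hSy0 hY.le)
    have h5 : θ * (Sy / (1 + Sy)) ≤ (65 / 64) * 1373 * (M * F) := by nlinarith only [h3, h4]
    -- `Sy ≤ (1 + 1/64)·(Sy/(1+Sy))`
    have h6 : Sy ≤ (1 + 1 / 64) * (Sy / (1 + Sy)) := by
      rw [mul_div_assoc', le_div_iff₀ hY]; nlinarith only [hy1, hSy0]
    have h7 := mul_le_mul_of_nonneg_right h6 hθpos.le
    have h8 : (1 + 1 / 64) * (Sy / (1 + Sy)) * θ = (65 / 64) * (θ * (Sy / (1 + Sy))) := by ring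
    rw [h8] at h7
    linarith only [h5, h7, hMF]
  have bZ : Sz ≤ 1829 * (M * F) := by
    have h6 : Sz ≤ (1 + 1 / 64) * (Sz / (1 + Sz)) := by
      rw [mul_div_assoc', le_div_iff₀ (by linarith only [hSz])]; nlinarith only [hz1, hSz]
    linarith only [h6, fz, hMF]
  have bF : SF ≤ 7020 * (M₄ * M) * F := by
    have h6 : SF ≤ (1 + 1 / 64) * (SF / (1 + SF)) := by
      rw [mul_div_assoc', le_div_iff₀ (by linarith only [hSF])]; nlinarith only [hF1, hSF]
    nlinarith only [h6, hΦ, fF', hF, hMM0]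
  -- the sum
  have hsum : R ^ 2 * θ ≤ (480 + 1200 + 1450) * (M * F) + θ * (1829 * (M * F) + 7020 * (M₄ * M) * F) := by
    have e := mul_le_mul_of_nonneg_right hfar hθpos.le
    nlinarith only [e, bδ, bX, bY, bZ, bF, hθpos, hSz, hSF, hMF, hF, hMM0]
  have hMMF : 0 ≤ M₄ * M * F := by positivity
  have ha : θ * (M₄ * M * F) ≤ 1 / 5 * (M₄ * M * F) := mul_le_mul_of_nonneg_right hθ5 hMMF
  have hb : θ * (M * F) ≤ 1 / 5 * (M * F) := mul_le_mul_of_nonneg_right hθ5 hMF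
  have hc : M * F ≤ M₄ * (M * F) := le_mul_of_one_le_left hMF hM₄
  linarith only [hsum, ha, hb, hc, hMF, hMMF]


/-- `Σ_f t_f/(1+t_f) ≥ (Σ_f t_f)/(1 + Σ_f t_f)` for non-negative `t`. [folklore] -/
theorem bfar_sum_frac_ge {ι : Type*} [Fintype ι] (t : ι → ℝ) (ht : ∀ i, 0 ≤ t i) :
    (∑ i, t i) / (1 + ∑ i, t i) ≤ ∑ i, t i / (1 + t i) := by
  have hS : 0 ≤ ∑ i, t i := Finset.sum_nonneg fun i _ => ht i
  rw [Finset.sum_div]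
  refine Finset.sum_le_sum fun i _ => ?_
  have hle : t i ≤ ∑ j, t j := Finset.single_le_sum (fun j _ => ht j) (Finset.mem_univ i)
  exact div_le_div_of_nonneg_left (ht i) (by linarith [ht i]) (by linarith)

/-- ★★★ **THE FAR FLOOR WITH THE CONSTANT `λ_B`** (letters): at the hub `hubAt δ 1` with `δ² ≤ ⅓` (the seam window for `τ ≤ ½`), on `x₁² + x₂² ≥ τ²` (`0 < τ ≤ ½`),
under the axial cap `x₀² ≤ 1 + x₁² + x₂²` (`X₁ = 1`), for EVERY sign pattern and every `0 ≤ R ≤ ⅛` with `R² ≤ δ² + x₀²/(1+|u|²) + |y|² + |z|² + Σ_f|η_f|²`: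
`τ²/((1+τ²)·12375·L¹⁰)·R² ≤ gnoDeficit 0 1 (hubAt δ 1) ε η`. [cite: Luscher1983, §2] [cite: tHooft1979] -/
theorem bTubeCap_far_floor_lambdaB (δ τ R : ℝ) (hτ : 0 < τ) (hτ2 : τ ≤ 1 / 2) (hδ : δ ^ 2 ≤ 1 / 3) (hR0 : 0 ≤ R) (hR8 : R ≤ 1 / 8)
    (ε : GnoSign L) (η : GnoCoord L) (hu : τ ^ 2 ≤ (η.1.1 1) ^ 2 + (η.1.1 2) ^ 2) (hx0 : (η.1.1 0) ^ 2 ≤ 1 + ((η.1.1 1) ^ 2 + (η.1.1 2) ^ 2))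
    (hfar : R ^ 2 ≤ δ ^ 2 + (η.1.1 0) ^ 2 / (1 + ((η.1.1 1) ^ 2 + (η.1.1 2) ^ 2)) + ((η.1.2 0) ^ 2 + (η.1.2 1) ^ 2 + (η.1.2 2) ^ 2) +
      ((η.2.1 0) ^ 2 + (η.2.1 1) ^ 2 + (η.2.1 2) ^ 2) + ∑ i : Fol L, ((η.2.2 i 0) ^ 2 + (η.2.2 i 1) ^ 2 + (η.2.2 i 2) ^ 2)) :
    τ ^ 2 / ((1 + τ ^ 2) * (12375 * (L : ℝ) ^ 10)) * R ^ 2 ≤ gnoDeficit (fun _ => false) (fun _ => 1) (hubAt δ 1) ε η := by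
  have ha : hubAt δ 1 ≠ 0 := hubAt_one_ne_zero δ
  obtain ⟨-, hre, -, hn2⟩ := bfar_hubAt_facts δ
  have him : ‖(hubAt δ 1).im‖ = 1 := norm_im_hubAt_one δ
  have hL1 : (1 : ℝ) ≤ L := by exact_mod_cast NeZero.one_le
  have fz := gnoDeficit_floor_z (L := L) ha ε η
  have fy := gnoDeficit_floor_yPerp (L := L) ha ε η
  have fyx := gnoDeficit_floor_yAxial (L := L) (hubAt δ 1) ε η
  have fδ := gnoDeficit_floor_hubPolar (L := L) ha ε η
  have ft := gnoDeficit_floor_tilt (L := L) ha ε η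
  have fF := gnoDeficit_floor_followers (L := L) (hubAt δ 1) ε η
  rw [him, hn2, hre] at fδ
  rw [him, hn2] at fy ft
  have hΦ := bfar_sum_frac_ge (fun i : Fol L => (η.2.2 i 0) ^ 2 + (η.2.2 i 1) ^ 2 + (η.2.2 i 2) ^ 2) fun i => by positivity
  have h := bfar_cap_scalar_lambdaB (M := (L : ℝ) ^ 6) (M₄ := (L : ℝ) ^ 4) (N := (Fintype.card (Fol L) : ℝ)) hτ hτ2 hδ
    (one_le_pow₀ hL1) (one_le_pow₀ hL1) card_fol_real_le (gnoDeficit_nonneg _ _ _ _ _) (by positivity) (Finset.sum_nonneg fun i _ => by positivity)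
    hR0 hR8 hu hx0 fz fy fyx fδ ft fF hΦ hfar
  have e : (L : ℝ) ^ 10 = (L : ℝ) ^ 4 * (L : ℝ) ^ 6 := by ring
  rw [e]; exact h

/-- ★★★ **THE `hfar` SOCKET OF ✓`bTubeCap_stiff_of_farFloor`, DISCHARGED** (w2 g59's letters, principal signs or not — every `ε`): for `0 < τ ≤ ½`, a cap `0 ≤ X₁ ≤ 1`
(LEAD g99: `X₁ = 1`) and `0 ≤ R ≤ ⅛`, every rescaled B-fibre point `Ψ′_B(u, y) = gnoFibreBEquiv (u, gnoScaleB u y)` over `τ² ≤ |u|²` with `R ≤ ‖y‖` that lies in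
the `(δ, η)`-image of `BTubeCap L τ X₁` satisfies `λ_B·R² ≤ F̂` with `λ_B = τ²/((1+τ²)·12375·L¹⁰)`. [cite: Luscher1983, §2] [cite: tHooft1979] -/
theorem bTubeCap_hfar (ε : GnoSign L) {τ X₁ R : ℝ} (hτ : 0 < τ) (hτ2 : τ ≤ 1 / 2) (hX0 : 0 ≤ X₁) (hX1 : X₁ ≤ 1) (hR0 : 0 ≤ R) (hR8 : R ≤ 1 / 8) :
    ∀ u : ℝ × ℝ, τ ^ 2 ≤ u.1 ^ 2 + u.2 ^ 2 → ∀ y : GnoFibreB L, R ≤ ‖y‖ → gnoFibreBEquiv (u, gnoScaleB u y) ∈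
      ({p : ℝ × GnoCoord L | 4 * p.1 ^ 2 / (1 + p.1 ^ 2) ^ 2 < τ ∧ τ ≤ (1 + p.1 ^ 2)⁻¹ ∧ |p.1| < τ * Real.sqrt (1 + p.1 ^ 2)} ∩
            {p : ℝ × GnoCoord L | τ ≤ Real.sqrt (p.2.1.1 1 ^ 2 + p.2.1.1 2 ^ 2)} ∩
            {p : ℝ × GnoCoord L | |p.2.1.1 0| ≤ X₁ * Real.sqrt (1 + p.2.1.1 1 ^ 2 + p.2.1.1 2 ^ 2)}) →
      τ ^ 2 / ((1 + τ ^ 2) * (12375 * (L : ℝ) ^ 10)) * R ^ 2 ≤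
        gnoDeficit (fun _ => false) (fun _ => 1) (hubAt (gnoFibreBEquiv (u, gnoScaleB u y)).1 1) ε (gnoFibreBEquiv (u, gnoScaleB u y)).2 := by
  intro u hu y hy hmem
  rw [gnoFibreBEquiv_gnoScaleB] at hmem ⊢
  simp only [Set.mem_inter_iff, Set.mem_setOf_eq, Matrix.cons_val_zero, Matrix.cons_val_one, Matrix.cons_val_two, Matrix.head_cons,
    Matrix.tail_cons] at hmem
  obtain ⟨⟨⟨-, -, hwin⟩, -⟩, hcap⟩ := hmem
  -- the seam window: `δ² ≤ 1/3`
  set d : ℝ := y (Sum.inl (Sum.inl 0)) with hd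
  have hsq1 : 0 ≤ Real.sqrt (1 + d ^ 2) := Real.sqrt_nonneg _
  have hδ : d ^ 2 ≤ 1 / 3 := by
    have h1 : |d| ^ 2 ≤ (τ * Real.sqrt (1 + d ^ 2)) ^ 2 := pow_le_pow_left₀ (abs_nonneg _) hwin.le 2
    rw [sq_abs, mul_pow, Real.sq_sqrt (by positivity)] at h1
    have hτsq : τ ^ 2 ≤ 1 / 4 := by nlinarith [hτ, hτ2]
    have h2 := mul_le_mul_of_nonneg_right hτsq (show (0 : ℝ) ≤ 1 + d ^ 2 by positivity)
    linarith [h1, h2]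
  -- the cap: `x₀² ≤ 1 + |u|²`
  set c : ℝ := Real.sqrt (1 + (u.1 ^ 2 + u.2 ^ 2)) with hc
  have hc2 : c ^ 2 = 1 + (u.1 ^ 2 + u.2 ^ 2) := Real.sq_sqrt (by positivity)
  have hcpos : 0 < c := Real.sqrt_pos.2 (by positivity)
  have hcap' : (c * y (Sum.inl (Sum.inl 1))) ^ 2 ≤ 1 + (u.1 ^ 2 + u.2 ^ 2) := by
    have e1 : Real.sqrt (1 + u.1 ^ 2 + u.2 ^ 2) = c := by rw [hc, add_assoc]
    rw [e1] at hcap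
    have h1 : |c * y (Sum.inl (Sum.inl 1))| ^ 2 ≤ (X₁ * c) ^ 2 := pow_le_pow_left₀ (abs_nonneg _) hcap 2
    rw [sq_abs, mul_pow, hc2, mul_pow, hc2] at h1
    rw [mul_pow, hc2]
    have hX2 : X₁ ^ 2 ≤ 1 := by nlinarith [hX0, hX1]
    have h2 := mul_le_mul_of_nonneg_right hX2 (show (0 : ℝ) ≤ 1 + (u.1 ^ 2 + u.2 ^ 2) by positivity)
    linarith [h1, h2]
  -- the far hypothesis in letters
  have hn := norm_sq_gnoFibreB_letters y
  have hR2 : R ^ 2 ≤ ‖y‖ ^ 2 := pow_le_pow_left₀ hR0 hy 2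
  have hx0sq : (c * y (Sum.inl (Sum.inl 1))) ^ 2 / (1 + (u.1 ^ 2 + u.2 ^ 2)) = y (Sum.inl (Sum.inl 1)) ^ 2 := by
    rw [mul_pow, hc2]; field_simp
  have hfar : R ^ 2 ≤ d ^ 2 + (c * y (Sum.inl (Sum.inl 1))) ^ 2 / (1 + (u.1 ^ 2 + u.2 ^ 2)) +
      (y (Sum.inl (Sum.inl 2)) ^ 2 + y (Sum.inl (Sum.inr 0)) ^ 2 + y (Sum.inl (Sum.inr 1)) ^ 2) +
      ((fun k => y (Sum.inr (Sum.inl k))) 0 ^ 2 + (fun k => y (Sum.inr (Sum.inl k))) 1 ^ 2 + (fun k => y (Sum.inr (Sum.inl k))) 2 ^ 2) +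
      ∑ i : Fol L, ((fun f k => y (Sum.inr (Sum.inr (f, k)))) i 0 ^ 2 + (fun f k => y (Sum.inr (Sum.inr (f, k)))) i 1 ^ 2 +
        (fun f k => y (Sum.inr (Sum.inr (f, k)))) i 2 ^ 2) := by
    rw [hx0sq]
    have e : ‖y‖ ^ 2 = d ^ 2 + y (Sum.inl (Sum.inl 1)) ^ 2 +
        (y (Sum.inl (Sum.inl 2)) ^ 2 + y (Sum.inl (Sum.inr 0)) ^ 2 + y (Sum.inl (Sum.inr 1)) ^ 2) +
        ((fun k => y (Sum.inr (Sum.inl k))) 0 ^ 2 + (fun k => y (Sum.inr (Sum.inl k))) 1 ^ 2 + (fun k => y (Sum.inr (Sum.inl k))) 2 ^ 2) +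
        ∑ i : Fol L, ((fun f k => y (Sum.inr (Sum.inr (f, k)))) i 0 ^ 2 + (fun f k => y (Sum.inr (Sum.inr (f, k)))) i 1 ^ 2 +
          (fun f k => y (Sum.inr (Sum.inr (f, k)))) i 2 ^ 2) := by
      rw [hn]; simp only [normSq3, Fin.sum_univ_three, hd]; ring
    linarith
  exact bTubeCap_far_floor_lambdaB (L := L) d τ R hτ hτ2 hδ hR0 hR8 ε _ hu hcap' hfar

end Summit.QuantumFields.YangMills.Theorems.SwapVirialDeficit.BlowUpRing

end
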